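import Literature.NumberTheory.Transcendental.KaehlerHodgeConjProofs
import Literature.NumberTheory.Transcendental.KaehlerHodgeDelLaplacianFact
import HarnessLib

/-!
# `dolbeaultHarmonicForms_conj`: corrected statement (holomorphic atlas as a binder) and glue

`Literature/NumberTheory/Transcendental/KaehlerHodge.lean` renders "complex conjugation
interchanges `ℋ^{p,q}_∂̄` and `ℋ^{q,p}_∂̄` on a Kähler manifold" (Voisin (2002), §6.1.2, Thm. 6.7
`Δ_∂ = Δ_∂̄ = ½Δ_d`, Cor. 6.10, and §6.1.3, Cor. 6.12 `\overline{H^{p,q}} = H^{q,p}`; Huybrechts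
(2005), §3.2, Remarks 3.2.7 (i); Griffiths–Harris (1978), p. 116) as the named fact
`Literature.NumberTheory.Transcendental.dolbeaultHarmonicForms_conj g o`. That `def … : Prop` was
written after the section `variable … [IsManifold 𝓘(ℂ, E) ω M] [IsManifold 𝓘(ℝ, E) ∞ M] (g …) (o …)`
of `section Kaehler`; a `def` abstracts only the section variables its body *uses*, and nothing in
the body uses the complex-structure instance (the metric `g` is typed over the real `C^∞` tangent
bundle only). Its elaborated binders are therefore
`E, M` (normed-space / charted-space instances), `k m`, `[FiniteDimensional ℂ E]`, `n`,
`[Fact (finrank ℝ E = n)]`, `[IsManifold 𝓘(ℝ, E) ∞ M]`, `g`, `o` (checked with `#check`) — the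
holomorphic atlas `[IsManifold 𝓘(ℂ, E) ω M]` is **not** among them. This is the accident already
recorded for its siblings `cHodgeLaplacian_eq_two_smul_dolbeaultLaplacian` (*Correction* in
`KaehlerHodge.lean`), `dolbeaultLaplacian_eq_delLaplacian` (`KaehlerHodgeDelLaplacianFact.lean`),
`typeComponent_mem_charmonicForms` (`KaehlerHodgeTypeComponentFact.lean`) and, earlier, for
`isSmoothForm_kaehlerForm` of `Literature/Geometry/Kaehler/Kaehler.lean`. As a `Prop` family the
fact thus ranges over **every real `C^∞` atlas** on `M` with values in the complex vector space `E`,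
the "complex structure" `J = i • id` of `TangentSpace 𝓘(ℝ, E) x = E` — and with it `IsOfType`,
`typeComponent`, `∂̄`, `∂̄*`, `Δ_∂̄` — being read in the preferred chart at `x`; the sources state it
for *complex* (Kähler) manifolds. It is therefore **mis-stated** (stated in greater generality than
its sources).

**In that generality the statement is moreover false** — formally refuted in
`Literature/NumberTheory/Transcendental/KaehlerHodgeConjCounterexample.lean`
(`OriginSwapAtlas.not_dolbeaultHarmonicForms_conj_Mc2`, and the universal closure over exactly the
binders of the fact, `not_dolbeaultHarmonicForms_conj`; also `not_forall_dolbeaultHarmonicForms_conj`),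
along the following lines. Take `M = ℂ²` (coordinates `z, w`) with the real-smooth
two-chart atlas `{id, A}`, `A(z, w) = (z, w̄)`, the chart `A` being preferred at the origin only;
the flat metric (smooth: `A` is an isometry), which is Hermitian for the chart-wise `J` (`= i` off
`0`, `= (i, -i)` at `0`, both orthogonal) and Kähler in the sense of `IsKaehler` (its Kähler form is
constant off `0`, and at `0` its chart representative is discontinuous, so `mextDeriv` returns `0`
there); the orientation family read in the preferred charts (smooth volume form); degrees `k = 1`,
`m = 3`, `n = 4`, `(p, q) = (1, 0)`. Reading forms in the global coordinates, type projections at `0`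
are taken with respect to `J' = (i, -i)`, whose `(1,0)`-covectors are `dz, dw̄` and `(0,1)`-covectors
`dz̄, dw`. (i) The smooth `1`-form `α = (z̄ + 1) w̄ dz` has type `(1,0)` (it vanishes at `0`) and a
harmonic coefficient; `∂̄*α = 0` exactly (`⋆α` has type `(2,1)` and `∂` of a `(2,1)`-form on `ℂ²`
vanishes), while `∂̄α = (dα)^{1,1}` equals `-w̄ dz∧dz̄ - (z̄ + 1) dz∧dw̄` off `0` but is `0` at `0`
(`dα(0) = -dz∧dw̄` has `J'`-type `(2,0)`): the chart representative of `⋆∂̄α` at `0` is discontinuous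
there, `mextDeriv (⋆∂̄α) 0 = 0` (Mathlib's junk value), and off `0` one finds
`d⋆∂̄α = -dz∧dz̄∧dw̄`, of type `(1,2)`, killed by the projection to type `(2,1)` inside `∂`. Hence
`Δ_∂̄ α = ∂̄*∂̄α = 0` everywhere: `α` is `∂̄`-harmonic of type `(1,0)`, `α ∈ ℋ^{1,0}`. (ii) For *every*
smooth `β = c dz̄ + e dw̄` of type `(0,1)` (which forces `e(0) = 0`) no junk value can enter
`∂̄*β = -⋆d⋆β = -2(c_z + e_w)` (`⋆β` is smooth and of `J'`-type `(1,2)` at `0`), so the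
`dw`-coefficient of `∂̄∂̄*β (0) = ((d ∂̄*β)(0))^{0,1}_{J'}` is `-2(c_{zw} + e_{ww})(0)`, whereas
`∂̄*∂̄β (0) ∈ ℂ dz̄` whichever value (junk `0` or honest) `mextDeriv (⋆∂̄β) 0` takes. So the linear
functional `L(β) = (c_{zw} + e_{ww})(0)` vanishes on every `∂̄`-harmonic `(0,1)`-form, hence on their
`ℂ`-span `ℋ^{0,1}`; but `L(ᾱ) = L((z + 1) w dz̄) = 1`. Thus `ᾱ ∈ \overline{ℋ^{1,0}} ∖ ℋ^{0,1}` and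
`(ℋ^{1,0}).map conj ≠ ℋ^{0,1}`. (Consistently, `Δ_∂ α (0) = \overline{Δ_∂̄ ᾱ (0)} = -2 dw̄ ≠ 0 =
Δ_∂̄ α (0)`: the mis-stated Kähler identity `Δ_∂̄ = Δ_∂` fails at the rigged point, as recorded in
`KaehlerHodgeDelLaplacianFact.lean`.) In complex dimension `1` no such example exists with these
riggings (a chart-wise `J` compatible with a Hermitian metric is `±i` there, types merely swap, and
on pure types the two Laplacians vanish together), which is why the witness lives on `ℂ²`.

This file records, following the precedent of `Kaehler.lean`, `KaehlerHodgeDelLaplacianFact.lean`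
and `KaehlerHodgeTypeComponentFact.lean` (a mis-stated named fact is corrected under a new name,
never edited in place):

* `dolbeaultHarmonicForms_conj_of_isManifold_complex g o` — the **corrected statement**, with the
  holomorphic atlas `[IsManifold 𝓘(ℂ, E) ω M]` an instance binder *of the `def`* and the body
  verbatim that of the old fact (same citation);
* `dolbeaultHarmonicForms_conj_of_isManifold_complex_iff` — at a complex manifold the corrected
  `Prop` is definitionally the old one;
* the **glue**, all proved: the corrected fact follows from the corrected Kähler identity
  `dolbeaultLaplacian_eq_delLaplacian_of_isManifold_complex g o` (`Δ_∂̄ = Δ_∂`,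
  `KaehlerHodgeDelLaplacianFact.lean`), from `cHodgeLaplacian_eq_two_smul_dolbeaultLaplacian_of_isManifold_complex g o`
  (`Δ_d = 2Δ_∂̄`, `KaehlerHodge.lean`), and from the first-order Kähler identities
  `KaehlerIdentities o Λ` (`[Λ, ∂̄] = -i∂*`, `[Λ, ∂] = i∂̄*`, Voisin (2002), Prop. 6.5) for some
  contraction family `Λ` of the metric `g` — by the conjugation plumbing of
  `KaehlerHodgeConjProofs.lean` (`Δ_∂̄ ᾱ = \overline{Δ_∂ α}`, any metric) and the algebraic step
  `KaehlerHodgeLaplacianProofs.lean`.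

What remains for a discharge `dolbeaultHarmonicForms_conj_of_isManifold_complex_holds` is exactly
what remains for `dolbeaultLaplacian_eq_delLaplacian_of_isManifold_complex_holds`: Voisin's
Prop. 6.5 for the adjoint `Λ = ⋆⁻¹L⋆` of the Lefschetz operator of a Kähler metric (pointwise
Lefschetz/contraction operators on forms, the flat identity Lemma 6.6, osculating holomorphic
coordinates Prop. 3.14), none of which is in the tree yet. No other named fact is introduced; the
old `def` is untouched (its Lean consumers — the reductions of `KaehlerHodgeConjProofs.lean`, and
`KaehlerHodgeSymmProofs.lean` / `HodgeDecompositionProofs.lean`, which take it as a hypothesis —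
are served by the `_iff` below at a complex manifold).

## References

* C. Voisin, *Hodge Theory and Complex Algebraic Geometry I*, Cambridge Studies in Advanced
  Mathematics 76 (2002), §6.1.1 Prop. 6.5, Lemma 6.6; §6.1.2 Thm. 6.7, Cor. 6.10 (p. 142: "`ℋ^{p,q}`
  … is also the set of forms of type `(p,q)` which are harmonic for `Δ_∂̄`"); §6.1.3 Cor. 6.12
  (`\overline{H^{p,q}} = H^{q,p}`); §3.1.3 Prop. 3.14.
* D. Huybrechts, *Complex Geometry. An Introduction*, Universitext (2005), §3.1 Prop. 3.1.12;
  §3.2 Prop. 3.2.6, Remarks 3.2.7 (i) ("complex conjugation interchanges `ℋ^{p,q}_∂̄(X, g)` and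
  `ℋ^{q,p}_∂̄(X, g)`"), Cor. 3.2.12.
* P. Griffiths, J. Harris, *Principles of Algebraic Geometry* (1978), pp. 115–116.
-/

noncomputable section

open scoped Manifold ContDiff
open Bundle Module

namespace Literature.NumberTheory.Transcendental

open Literature.Geometry.Kaehler (MForm IsSmoothForm)

variable {E : Type*} [NormedAddCommGroup E] [NormedSpace ℂ E]
  {M : Type*} [TopologicalSpace M] [ChartedSpace E M] {k m : ℕ}
  [FiniteDimensional ℂ E] {n : ℕ} [Fact (finrank ℝ E = n)] [IsManifold 𝓘(ℝ, E) ∞ M]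
  (g : ContMDiffRiemannianMetric 𝓘(ℝ, E) ∞ E (fun x : M ↦ TangentSpace 𝓘(ℝ, E) x))
  (o : (x : M) → Orientation ℝ (TangentSpace 𝓘(ℝ, E) x) (Fin n))

/-- **`\overline{ℋ^{p,q}} = ℋ^{q,p}` on a Kähler manifold — corrected statement** of
`Literature.NumberTheory.Transcendental.dolbeaultHarmonicForms_conj` (same citation). Let `M` be a
**complex** manifold (holomorphic atlas: the instance `[IsManifold 𝓘(ℂ, E) ω M]` is a binder *of
this `def`*, so that the `Prop` is only stated for complex manifolds), `g` a smooth Riemannian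
metric on its real tangent bundle and `o` an orientation family. Then: if `g` is Kähler (`hg`:
Hermitian with closed Kähler form) and the volume form of `o` is smooth, for all degrees
`h : k + m = n = dim_ℝ M` and all `(p, q)`, complex conjugation (the conjugate-linear
`MForm.conjₛₗ k`) maps the space `ℋ^{p,q} = dolbeaultHarmonicForms o p q h` of `∂̄`-harmonic
`(p,q)`-forms (smooth, of type `(p,q)`, `Δ_∂̄ α = 0` for `Δ_∂̄ = ∂̄∂̄* + ∂̄*∂̄`, `∂̄* = -⋆∂⋆` with the
`ℂ`-linear Hodge star of `g`) onto `ℋ^{q,p}`. Voisin (2002), §6.1.2, Thm. 6.7 and Cor. 6.10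
(p. 142), §6.1.3, Cor. 6.12 ("`\overline{H^{p,q}} = H^{q,p}`", `X` a compact Kähler — in particular
complex — manifold; the harmonic-space statement needs no compactness); Huybrechts (2005), §3.2,
Remarks 3.2.7 (i) ("If `X` is Kähler … complex conjugation interchanges `ℋ^{p,q}_∂̄(X, g)` and
`ℋ^{q,p}_∂̄(X, g)`", `X` a complex manifold, via Prop. 3.1.12 `Δ_∂ = Δ_∂̄`); Griffiths–Harris (1978),
p. 116. The body is verbatim that of the old fact, which lacks the complex-manifold binder and is
false over general real atlases (`not_dolbeaultHarmonicForms_conj`, `KaehlerHodgeConjCounterexample.lean`: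
`ℂ²` with the chart `(z, w) ↦ (z, w̄)` preferred at the origin, `α = (z̄ + 1) w̄ dz`). Not proved here: it follows from the Kähler identity `Δ_∂̄ = Δ_∂`
(`…_of_dolbeaultLaplacian_eq_delLaplacian` below), whose first-order form (Voisin (2002), Prop. 6.5)
is not yet in the tree. [cite: Voisin2002, §6.1.2 Thm. 6.7, Cor. 6.10; §6.1.3 Cor. 6.12] -/
def dolbeaultHarmonicForms_conj_of_isManifold_complex [IsManifold 𝓘(ℂ, E) ω M] : Prop :=
  ∀ (hg : g.toRiemannianMetric.IsKaehler) (h : k + m = n) (p q : ℕ),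
    letI : RiemannianBundle (fun x : M ↦ TangentSpace 𝓘(ℝ, E) x) := ⟨g.toRiemannianMetric⟩
    IsSmoothForm (Literature.Geometry.Kaehler.riemannianVolumeForm o) →
      (dolbeaultHarmonicForms o p q h).map (Literature.Geometry.Kaehler.MForm.conjₛₗ k) =
        dolbeaultHarmonicForms o q p h

/-- At a complex manifold the corrected fact *is* the old `Prop` `dolbeaultHarmonicForms_conj g o`
(identical bodies), so a future discharge of the corrected fact serves every consumer written
against the old name, and the reductions of `KaehlerHodgeConjProofs.lean` serve the corrected
fact. [folklore] -/
theorem dolbeaultHarmonicForms_conj_of_isManifold_complex_iff [IsManifold 𝓘(ℂ, E) ω M] :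
    dolbeaultHarmonicForms_conj_of_isManifold_complex (k := k) (m := m) g o ↔
      dolbeaultHarmonicForms_conj (k := k) (m := m) g o :=
  Iff.rfl

/-- **The corrected fact from the corrected Kähler identity `Δ_∂̄ = Δ_∂`.** On a complex manifold,
`dolbeaultLaplacian_eq_delLaplacian_of_isManifold_complex g o` (Voisin (2002), Thm. 6.7;
`KaehlerHodgeDelLaplacianFact.lean`) implies `dolbeaultHarmonicForms_conj_of_isManifold_complex g o`:
for a `∂̄`-harmonic `(p,q)`-form `α`, `ᾱ` is smooth of type `(q,p)` and
`Δ_∂̄ ᾱ = \overline{Δ_∂ α} = \overline{Δ_∂̄ α} = 0` (`dolbeaultLaplacian_conj`), and conjugation is an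
involution, so the spans are exchanged — the printed proof of Huybrechts (2005), §3.2,
Remarks 3.2.7 (i) / Voisin (2002), Cor. 6.10, here via
`dolbeaultHarmonicForms_conj_of_dolbeaultLaplacian_eq_delLaplacian` of `KaehlerHodgeConjProofs.lean`.
[cite: Huybrechts2005, §3.2 Rem. 3.2.7 (i)] -/
theorem dolbeaultHarmonicForms_conj_of_isManifold_complex_of_dolbeaultLaplacian_eq_delLaplacian
    [IsManifold 𝓘(ℂ, E) ω M]
    (hK : dolbeaultLaplacian_eq_delLaplacian_of_isManifold_complex (k := k) (m := m) g o) :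
    dolbeaultHarmonicForms_conj_of_isManifold_complex (k := k) (m := m) g o :=
  dolbeaultHarmonicForms_conj_of_dolbeaultLaplacian_eq_delLaplacian g o hK

/-- **The corrected fact from the corrected Kähler identity `Δ_d = 2Δ_∂̄`.** On a complex manifold,
`cHodgeLaplacian_eq_two_smul_dolbeaultLaplacian_of_isManifold_complex g o` (Voisin (2002), Thm. 6.7;
end of `KaehlerHodge.lean`) implies `dolbeaultHarmonicForms_conj_of_isManifold_complex g o`: for a
`∂̄`-harmonic `(p,q)`-form `α`, `2Δ_∂̄ ᾱ = Δ_d ᾱ = \overline{Δ_d α} = \overline{2Δ_∂̄ α} = 0` (`Δ_d` is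
a real operator, `cHodgeLaplacian_conj`) — Voisin's route (Cor. 6.10: `ℋ^{p,q}` is the space of
`(p,q)`-forms harmonic for the real operator `Δ_d`), via
`dolbeaultHarmonicForms_conj_of_cHodgeLaplacian_eq_two_smul_dolbeaultLaplacian`.
[cite: Voisin2002, §6.1.2 Thm. 6.7, Cor. 6.10] -/
theorem dolbeaultHarmonicForms_conj_of_isManifold_complex_of_cHodgeLaplacian_eq_two_smul
    [IsManifold 𝓘(ℂ, E) ω M]
    (hK : cHodgeLaplacian_eq_two_smul_dolbeaultLaplacian_of_isManifold_complex (k := k) (m := m) g o) :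
    dolbeaultHarmonicForms_conj_of_isManifold_complex (k := k) (m := m) g o :=
  dolbeaultHarmonicForms_conj_of_cHodgeLaplacian_eq_two_smul_dolbeaultLaplacian g o hK

/-- **The corrected fact from the first-order Kähler identities.** On a complex manifold with a
smooth metric `g`, if some contraction family `Λ` satisfies `KaehlerIdentities o Λ` for the metric
`g` (`[Λ, ∂̄] = -i∂*`, `[Λ, ∂] = i∂̄*`: Voisin (2002), Prop. 6.5, for `Λ = ⋆⁻¹L⋆` when `g` is Kähler;
Huybrechts (2005), Prop. 3.1.12 (ii)), then conjugation exchanges `ℋ^{p,q}` and `ℋ^{q,p}` for `g`: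
Prop. 3.1.12 (ii) ⇒ (iii) (`Δ_∂̄ = Δ_∂`, `KaehlerHodgeLaplacianProofs.lean`) ⇒ Remarks 3.2.7 (i).
This isolates exactly what a discharge of the corrected fact still needs. [cite: Huybrechts2005, Prop. 3.1.12, Rem. 3.2.7 (i)] -/
theorem dolbeaultHarmonicForms_conj_of_isManifold_complex_of_kaehlerIdentities
    [IsManifold 𝓘(ℂ, E) ω M] {Λ : (j : ℕ) → MForm 𝓘(ℝ, E) M ℂ (j + 2) → MForm 𝓘(ℝ, E) M ℂ j}
    (hΛ : letI : RiemannianBundle (fun x : M ↦ TangentSpace 𝓘(ℝ, E) x) := ⟨g.toRiemannianMetric⟩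
      KaehlerIdentities o Λ) :
    dolbeaultHarmonicForms_conj_of_isManifold_complex (k := k) (m := m) g o :=
  dolbeaultHarmonicForms_conj_of_dolbeaultLaplacian_eq_delLaplacian g o
    (dolbeaultLaplacian_eq_delLaplacian_of_kaehlerIdentities g o hΛ)

end Literature.NumberTheory.Transcendental
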